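/-
Copyright (c) 2026 the pub-hodgecm-mathlib formalisation cell (harness21).  Prover seat hodgecm-mathlib-K2E4-p10 (g9), Track B «K2-LIT»,
#184♮ = hLiu418 = `stmt-HodgeConjecture-24832`; socket #41, KIND W, (x-b) of LEAD F0P6-plan (g14) BATCH #62 (1) + desk K2E5-p17 RULINGS 2026-09-04T22:15:21Z ∕ 22:32:19Z
(«(β): per-place presentation, THE CONSUMER WRITES THE SOCKET»).  FILE 3 of this seat's (x-b) chain: the PACKAGING HEAD, stage 1 (global letters ⟹ the TOP's KIND-W block).
THEOREMS ONLY (no `def`, no `instance`, no notation, no named-fact hypothesis, no `sorry`).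
-/
import Summits.HodgeConjecture.HodgeConjecture.Theorems.K2LiuWhittakerDeltaEulerProduct        -- ★ G1: the KIND-W vocabulary (`whittakerDelta`, `skewMatrices`, `gramR`, `HA`, `unipDelta`)
import Summits.HodgeConjecture.HodgeConjecture.Theorems.K2LiuGoodPlaceWhittakerEulerAssembly   -- ★ G2: `partialStandardL`, `quadraticHeckeCharCM`
import Summits.HodgeConjecture.HodgeConjecture.Theorems.K2LiuSiegelEisensteinKindWInstance   -- ★ p862446 (this seat): §1 `hsupp_of_local`
import Summits.HodgeConjecture.HodgeConjecture.Theorems.K2LiuSiegelEisensteinKindWDecay      -- ★ p862527 (this seat): `hdec_of_letters`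
import HarnessLib

/-!
# Crux `HLiu418`, socket #41, KIND W — `K2LiuSiegelEisensteinKindWPackage`: THE PACKAGING HEAD, STAGE 1 —
# `(A, U, hEuler, hAd)` + `hdet0` + THE TWO GLOBAL LETTERS (S-loc), (D-loc) ⟹ THE TOP's KIND-W BLOCK `∃ A U, hEuler ∧ hAd ∧ ∃ τ N_W, hτ ∧ hdec ∧ ∃ C_W κ, 0 < C_W ∧ 0 ≤ κ ∧ hsupp`

Cell `hodgecm-mathlib`, crux item hLiu418 = `stmt-HodgeConjecture-24832` (helper lane `--supports … --as helper`, count-neutral), route of record `HCCMUnconditional`;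
squad K2 ∕ K2Liu, road `K2_Liu`, socket #41 `sig_K2LiuSiegelEisensteinContinuation`.  The TOP of record (★ ed. 16 `K2LiuSiegelEisensteinContinuationTopSixteen`, K2E5-p17
(g9)) carries KIND W as the by-value block `(A U hEuler hAd τ hτ NW hdec {CW κ} hCW hκ hsupp)` (:200–220; consumed by ★ p862137
`exists_whittaker_factorLetters_of_weightLetters`); the desk's pre-spec (2026-09-04T22:02:03Z) for the head that DROPS it is
  `exists_kindW_letters … : ∃ A U, «hEuler» ∧ «hAd» ∧ ∃ τ N_W, «hτ» ∧ «hdec» ∧ ∃ C_W κ, 0 < C_W ∧ 0 ≤ κ ∧ «hsupp»`  (conjuncts = TOP :200–220 in order).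
By the rulings of record (22:15:21Z: `A` is the CONTINUED `T`-part, ∃-bound, (x-a) F0P2-p08 (g2) `exists_kindW_eulerLetters`; 22:32:19Z (β): per-place presentation,
local → global is (x-b)'s genre, the consumer writes the socket) the package is assembled in TWO STAGES:
* STAGE 1 (THIS FILE) **`exists_kindW_letters_of_globalLetters`** — from the Euler data `(A, U, hEuler, hAd)` BY VALUE (TOP bytes), the KIND-W convention `hdet0`
  (`A S s h = 0` at `det S = 0`), and the two GLOBAL analytic letters on `A` in this lineage's currencies —
  **(S-loc)** the per-place-of-`L` lattice letter of ★ `K2LiuSiegelEisensteinKindWInstance.hsupp_of_local` (`A S s h ≠ 0 ⇒ ∀ w, ∃ m, N(𝔭_w)^m ≤ N(𝔭_w)^{δ_w} H_w(h)^k ∧ |S_{ab}|_w ≤ q_w^m`),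
  **(D-loc)** the decay letter of ★ `K2LiuSiegelEisensteinKindWDecay.hdec_of_letters` (the TOP's `hdec` shape TIMES the archimedean determinant defect
  `∏_{w∣∞} (1 + |det S|_w⁻¹)^{N′}`, with `τ S := ‖(ι_∞ S_{ij})_{ij}‖`) —
  to the TOP's block VERBATIM: `hτ := le_rfl`, `hsupp` by ★ `hsupp_of_local` (`ι := skewMatrices …`, `mat := (↑)`, `X := HA …`, `ht := (↑)`, `N := n + n`), `hdec` by
  ★ `hdec_of_letters` fed with that `hsupp`.
* STAGE 2 (next files of this seat, hypothesis-first on (x-a)'s PER-PLACE PRESENTATION `A S s h = Σ_j (∏_σ F_{∞,σ,j} S s h) · ∏_{v ∈ kindWFinset T₀ ↑S h} F_{v,j} S s h`):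
  per-place letters in the ★ local currencies ⟹ (S-loc), (D-loc), `hdet0` (arch: ★ `K2LiuSiegelEisensteinKindWArchDecay` pointwise decay face + ★ G7-C
  `detFactor_le_height`; finite: ★ §1.2 `exists_den_of_local_letters`, product formula for `det(D·S)` at the finite places, exceptional places against the height).
[MoeglinWaldspurger1995, II.1.7, IV.1.9], [KudlaRallis1994, §1–§2], [Tan1999, §2–§4], [Shimura1997, §18.4 Prop. 18.14], [BorelJacquet1979, §1.2].
HONEST LABEL.  Count-neutral helper, closes no socket: `HC_CM` is proved only modulo the 7 printed citations (2 remaining named inputs: hLiu418 =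
`stmt-HodgeConjecture-24832`, h413 = `stmt-HodgeConjecture-24833`) until rung 0 closes.
-/

set_option autoImplicit false
set_option linter.dupNamespace false -- the mandated namespace repeats `HodgeConjecture.HodgeConjecture`

noncomputable section

open scoped Matrix BigOperators NNReal
-- `Classical` is needed to see the Mathlib normed-ring instances on `mixedSpace L` (note H5 of ★ `AdelicGLnGlue`; as the TOP's `hτ`)
open scoped Classical
open NumberField NumberField.InfinitePlace IsDedekindDomain MeasureTheory

namespace Summit.HodgeConjecture.HodgeConjecture.Cruxes.HLiu418.K2LiuSiegelEisensteinKindWPackage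

open Literature.NumberTheory.Automorphic Literature.NumberTheory.GaloisRepresentations Literature.NumberTheory.LFunctions
open Literature.NumberTheory.GelbartRogawski1991 Literature.NumberTheory.GelbartRogawski1991.GRConstruction
open Literature.NumberTheory.K2Lit.SiegelDoubled
open Summit.HodgeConjecture.HodgeConjecture.Cruxes.HLiu418.K2LiuSiegelUnipotentFourierDefs
open Summit.HodgeConjecture.HodgeConjecture.Cruxes.HLiu418.K2LiuGoodPlaceWhittakerEulerAssembly
open Summit.HodgeConjecture.HodgeConjecture.Cruxes.HLiu418.K2LiuSiegelEisensteinKindWInstance (hsupp_of_local)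
open Summit.HodgeConjecture.HodgeConjecture.Cruxes.HLiu418.K2LiuSiegelEisensteinKindWDecay (hdec_of_letters)

/-- **KIND W, PACKAGING HEAD — STAGE 1: THE GLOBAL LETTERS GIVE THE TOP's BLOCK.**  Socket prefix `(L, e : Fin 2 × Fin 1 ≃ Fin n, dV hdV dW hdW)`, a carrier `νN` on `N_Δ(𝔸)`
and a family `f` (only through the BYTES of `hEuler`); the Euler data `(A, U, hEuler, hAd)` BY VALUE (TOP ★ ed. 16 :200–209 verbatim — (x-a)'s ∃-head supplies them for the
CONTINUED `T`-part); the KIND-W convention `hdet0 : det S = 0 → A S s h = 0`; the support datum `(T_δ, δ, k)` with the global lattice letter **(S-loc)** (the `hloc` of ★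
`hsupp_of_local` at `ι := skewMatrices …`, `X := HA …`, places `w` of `L`); the exponents `N₁ N′` with the global decay letter **(D-loc)** (the `hloc` of ★ `hdec_of_letters`:
the TOP's `hdec` shape at `τ S := ‖(ι_∞ S_{ij})_{ij}‖` times `∏_{w∣∞}(1 + |det S|_w⁻¹)^{N′}`).  THEN the TOP's KIND-W block, conjuncts :200–220 in order:
`∃ A U, hEuler ∧ hAd ∧ ∃ τ N_W, hτ ∧ hdec ∧ ∃ C_W κ, 0 < C_W ∧ 0 ≤ κ ∧ hsupp` (`τ S = ‖(ι_∞ S_{ij})_{ij}‖`, `hτ = le_rfl`; `hsupp` ★ `hsupp_of_local`; `hdec` ★ `hdec_of_letters`).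
[cite: MoeglinWaldspurger1995, II.1.7, IV.1.9] [cite: KudlaRallis1994, §1] [cite: Tan1999, §4 Prop. 4.8] [cite: Shimura1997, §18.4 Prop. 18.14] [cite: BorelJacquet1979, §1.2] -/
theorem exists_kindW_letters_of_globalLetters
    (L : Type) [Field L] [NumberField L] [IsCMField L] {n : ℕ} (e : Fin 2 × Fin 1 ≃ Fin n)
    (dV : Fin 2 → L) (hdV : ∀ i, IsCMField.complexConj L (dV i) = dV i)
    (dW : Fin 1 → L) (hdW : ∀ i, IsCMField.complexConj L (dW i) = dW i)
    [MeasurableSpace (unipDelta L e dV hdV dW hdW)] (νN : Measure (unipDelta L e dV hdV dW hdW)) (f : ℂ → HA L e dV hdV dW hdW → ℂ)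
    -- the Euler data BY VALUE ((x-a)'s ∃-head: the CONTINUED `T`-part and the exceptional place set)
    (A : skewMatrices ((IsCMField.complexConj L : L ≃ₐ[Fp L] L) : L →+* L) ((gramR L e dV hdV dW hdW).map (algebraMap (Fp L) L)) → ℂ → HA L e dV hdV dW hdW → ℂ)
    (U : skewMatrices ((IsCMField.complexConj L : L ≃ₐ[Fp L] L) : L →+* L) ((gramR L e dV hdV dW hdW).map (algebraMap (Fp L) L)) → HA L e dV hdV dW hdW →
      Set (HeightOneSpectrum (𝓞 ↥(maximalRealSubfield L))))
    (hEuler : ∀ S : skewMatrices ((IsCMField.complexConj L : L ≃ₐ[Fp L] L) : L →+* L) ((gramR L e dV hdV dW hdW).map (algebraMap (Fp L) L)),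
      (S : Matrix (Fin n) (Fin n) L).det ≠ 0 → ∀ (s : ℂ) (h : HA L e dV hdV dW hdW), (n : ℝ) / 2 < s.re →
        whittakerDelta L e dV hdV dW hdW νN (S : Matrix (Fin n) (Fin n) L) (f s) h =
          A S s h * (partialStandardL (U S h) (fun _ => {1}) (2 * s + 1) *
            partialStandardL (U S h) (fun v => {(quadraticHeckeCharCM L).valueAtUniformizer v}) (2 * s + 2))⁻¹)
    (hAd : ∀ S (h : HA L e dV hdV dW hdW), DifferentiableOn ℂ (fun s => A S s h) {s : ℂ | 0 < s.re})
    -- the KIND-W convention at the degenerate indices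
    (hdet0 : ∀ (S : skewMatrices ((IsCMField.complexConj L : L ≃ₐ[Fp L] L) : L →+* L) ((gramR L e dV hdV dW hdW).map (algebraMap (Fp L) L)))
      (s : ℂ) (h : HA L e dV hdV dW hdW), (S : Matrix (Fin n) (Fin n) L).det = 0 → A S s h = 0)
    -- (S-loc): the global lattice letter (places `w` of `L`; defect datum `(T_δ, δ)`, exponent `k`)
    (Tδ : Finset (HeightOneSpectrum (𝓞 L))) (δ : HeightOneSpectrum (𝓞 L) → ℕ) (hδ : ∀ w ∉ Tδ, δ w = 0) (k : ℕ)
    (hSloc : ∀ (S : skewMatrices ((IsCMField.complexConj L : L ≃ₐ[Fp L] L) : L →+* L) ((gramR L e dV hdV dW hdW).map (algebraMap (Fp L) L)))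
      (s : ℂ) (h : HA L e dV hdV dW hdW), 0 < s.re → A S s h ≠ 0 → ∀ w : HeightOneSpectrum (𝓞 L), ∃ m : ℕ,
        ((Ideal.absNorm w.asIdeal : ℕ) : ℝ) ^ m ≤
            ((Ideal.absNorm w.asIdeal : ℕ) : ℝ) ^ δ w * (GLn.localHeight (n + n) L w (h : GL (Fin (n + n)) (AdeleRing (𝓞 L) L)) : ℝ) ^ k ∧
          ∀ a b, Valued.v ((((S : Matrix (Fin n) (Fin n) L) a b : L)) : w.adicCompletion L) ≤ WithZero.exp (m : ℤ))
    -- (D-loc): the global decay letter carrying the archimedean determinant defect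
    (N₁ N' : ℕ)
    (hDloc : ∀ z : ℂ, 0 < z.re → ∃ C a c a' r : ℝ, 0 ≤ C ∧ 0 ≤ a ∧ 0 < c ∧ 0 ≤ a' ∧ 0 < r ∧
      ∀ (S : skewMatrices ((IsCMField.complexConj L : L ≃ₐ[Fp L] L) : L →+* L) ((gramR L e dV hdV dW hdW).map (algebraMap (Fp L) L))) (s : ℂ),
        dist s z < r → ∀ h : HA L e dV hdV dW hdW,
        ‖A S s h‖ ≤ C * adelicHeightGL (n + n) L (h : GL (Fin (n + n)) (AdeleRing (𝓞 L) L)) ^ a *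
          (Real.exp (-(c * adelicHeightGL (n + n) L (h : GL (Fin (n + n)) (AdeleRing (𝓞 L) L)) ^ (-a') *
              ‖(fun i j => NumberField.mixedEmbedding L ((S : Matrix (Fin n) (Fin n) L) i j))‖)) *
            (1 + ‖(fun i j => NumberField.mixedEmbedding L ((S : Matrix (Fin n) (Fin n) L) i j))‖) ^ N₁) *
          ∏ w : InfinitePlace L, (1 + (w (S : Matrix (Fin n) (Fin n) L).det)⁻¹) ^ N') :
    ∃ (A : skewMatrices ((IsCMField.complexConj L : L ≃ₐ[Fp L] L) : L →+* L) ((gramR L e dV hdV dW hdW).map (algebraMap (Fp L) L)) → ℂ → HA L e dV hdV dW hdW → ℂ)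
      (U : skewMatrices ((IsCMField.complexConj L : L ≃ₐ[Fp L] L) : L →+* L) ((gramR L e dV hdV dW hdW).map (algebraMap (Fp L) L)) → HA L e dV hdV dW hdW →
        Set (HeightOneSpectrum (𝓞 ↥(maximalRealSubfield L)))),
      (∀ S : skewMatrices ((IsCMField.complexConj L : L ≃ₐ[Fp L] L) : L →+* L) ((gramR L e dV hdV dW hdW).map (algebraMap (Fp L) L)),
        (S : Matrix (Fin n) (Fin n) L).det ≠ 0 → ∀ (s : ℂ) (h : HA L e dV hdV dW hdW), (n : ℝ) / 2 < s.re →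
          whittakerDelta L e dV hdV dW hdW νN (S : Matrix (Fin n) (Fin n) L) (f s) h =
            A S s h * (partialStandardL (U S h) (fun _ => {1}) (2 * s + 1) *
              partialStandardL (U S h) (fun v => {(quadraticHeckeCharCM L).valueAtUniformizer v}) (2 * s + 2))⁻¹) ∧
      (∀ S (h : HA L e dV hdV dW hdW), DifferentiableOn ℂ (fun s => A S s h) {s : ℂ | 0 < s.re}) ∧
      ∃ (τ : skewMatrices ((IsCMField.complexConj L : L ≃ₐ[Fp L] L) : L →+* L) ((gramR L e dV hdV dW hdW).map (algebraMap (Fp L) L)) → ℝ) (NW : ℕ),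
        (∀ S : skewMatrices ((IsCMField.complexConj L : L ≃ₐ[Fp L] L) : L →+* L) ((gramR L e dV hdV dW hdW).map (algebraMap (Fp L) L)),
          ‖(fun i j => NumberField.mixedEmbedding L ((S : Matrix (Fin n) (Fin n) L) i j))‖ ≤ τ S) ∧
        (∀ z : ℂ, 0 < z.re → ∃ C a c a' r : ℝ, 0 ≤ C ∧ 0 ≤ a ∧ 0 < c ∧ 0 ≤ a' ∧ 0 < r ∧ ∀ S (s : ℂ), dist s z < r → ∀ h : HA L e dV hdV dW hdW,
          ‖A S s h‖ ≤ C * adelicHeightGL (n + n) L (h : GL (Fin (n + n)) (AdeleRing (𝓞 L) L)) ^ a *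
            (Real.exp (-(c * adelicHeightGL (n + n) L (h : GL (Fin (n + n)) (AdeleRing (𝓞 L) L)) ^ (-a') * τ S)) * (1 + τ S) ^ NW)) ∧
        ∃ CW κ : ℝ, 0 < CW ∧ 0 ≤ κ ∧
          ∀ S (s : ℂ) (h : HA L e dV hdV dW hdW), 0 < s.re → A S s h ≠ 0 →
            ∃ D : ℕ, 1 ≤ D ∧ (D : ℝ) ≤ CW * adelicHeightGL (n + n) L (h : GL (Fin (n + n)) (AdeleRing (𝓞 L) L)) ^ κ ∧
              ∀ i j, IsIntegral ℤ ((D : L) * (S : Matrix (Fin n) (Fin n) L) i j) := by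
  have hn : 0 < n := by
    have h2 : Fintype.card (Fin 2 × Fin 1) = Fintype.card (Fin n) := Fintype.card_congr e
    simp only [Fintype.card_prod, Fintype.card_fin] at h2
    omega
  haveI : NeZero (n + n) := ⟨by omega⟩
  -- (S-loc) ⟹ `hsupp` (★ `hsupp_of_local`)
  obtain ⟨CW, κ, hCW, hκ, hsupp⟩ := hsupp_of_local L
    (fun S : skewMatrices ((IsCMField.complexConj L : L ≃ₐ[Fp L] L) : L →+* L) ((gramR L e dV hdV dW hdW).map (algebraMap (Fp L) L)) =>
      (S : Matrix (Fin n) (Fin n) L))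
    (fun h : HA L e dV hdV dW hdW => (h : GL (Fin (n + n)) (AdeleRing (𝓞 L) L))) A Tδ δ hδ k hSloc
  -- (D-loc) + `hsupp` ⟹ `hdec` (★ `hdec_of_letters`)
  obtain ⟨NW, hdec⟩ := hdec_of_letters L
    (fun S : skewMatrices ((IsCMField.complexConj L : L ≃ₐ[Fp L] L) : L →+* L) ((gramR L e dV hdV dW hdW).map (algebraMap (Fp L) L)) =>
      (S : Matrix (Fin n) (Fin n) L))
    (fun h : HA L e dV hdV dW hdW => (h : GL (Fin (n + n)) (AdeleRing (𝓞 L) L))) A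
    (fun S => ‖(fun i j => NumberField.mixedEmbedding L ((S : Matrix (Fin n) (Fin n) L) i j))‖) (fun S => le_rfl) hdet0 hCW hκ hsupp N₁ N' hDloc
  exact ⟨A, U, hEuler, hAd, fun S => ‖(fun i j => NumberField.mixedEmbedding L ((S : Matrix (Fin n) (Fin n) L) i j))‖, NW, fun S => le_rfl, hdec,
    CW, κ, hCW, hκ, hsupp⟩

end Summit.HodgeConjecture.HodgeConjecture.Cruxes.HLiu418.K2LiuSiegelEisensteinKindWPackage

end
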